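import Literature.AlgebraicGeometry.HodgeTheory.SymmetricA3MonodromyRelations
import Literature.AlgebraicGeometry.HodgeTheory.PencilCircleHomotopy
import Literature.AlgebraicGeometry.HodgeTheory.SymmetricA3FarSingularPoints
import Literature.AlgebraicGeometry.HodgeTheory.SymmetricA3BifurcationTheorem
import HarnessLib

/-!
# hB2 ⟸ hPL-uniform ∧ (the `A₃` operator relations): the Picard–Lefschetz pair data of the symmetric `A₃`
# unfolding from the uniform nodal Picard–Lefschetz package

Family `hodge`, layer `Literature/AlgebraicGeometry/HodgeTheory`; proof file (theorems only).  Written by the prover seat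
`hodge-nonav-19716-p2` (g9, cell `hodge-nonav`), programme «B2PL-SPLIT», for the binder hB2 = `picardLefschetz_symmetricA3`
of crux K1-B `VeryGeneralSignCommutatorsInHg` (`Summits/HodgeConjecture/HodgeConjecture/Theses/SignSymmetricPowers.lean`,
stmt-HodgeConjecture-19716).  Inputs, all tree theorems: the bifurcation theorem of programme B2-BIF
(`IsSymmetricA3Datum.exists_isSymmetricA3Bifurcation`), the gauge re-choice
(`symmetricA3PicardLefschetzClauses_of_pair_of_relations`, `SymmetricA3MonodromyRelations`), the typing seat's
«Picard–Lefschetz data at any radius» (`picardLefschetz_nodalForms_uniform.exists_isPicardLefschetzData_of_radius`, built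
on prover-Bx's `IsPicardLefschetzData.transport`), and the «far singular points» lemma of B2-BIF
(`IsSymmetricA3Datum.eventually_forall_singular_mem`).

* `IsSymmetricA3Bifurcation.exists_radius_eval_g₀_ne` — inside a bifurcation datum of a symmetric `A₃` datum there is a
  radius `εa' ≤ εa` below which `g₀` does not vanish at any singular point of the two-node member
  `f₁ + a' g₂ + ψ(a') g₀` (the nodes tend to `e_j`, where `g₀ ≠ 0`).
* `symmetricA3PicardLefschetzPair_of_uniform` — **(P1) ∧ (P2) ⟸ hPL-uniform**: on that radius, at the midpoint base
  point and for the two circles of hB2, the uniform package gives Picard–Lefschetz data for the one-node pencil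
  `(f₁ + a'g₂) + c·((ψ/2) g₀)` and the two-node pencil `(f₁ + a'g₂ + ψ g₀) + c·(−(ψ/2) g₀)` at radius `1`, BOTH with the
  flat coefficient `c(t₀)` — the common `c₀` of `SymmetricA3PicardLefschetzPair`.
* `symmetricA3PicardLefschetzClauses_inline_of_uniform_of_relations` — hB2-PL (inline form of registry v18 of K1-B) ⟸
  `picardLefschetz_nodalForms_uniform` ∧ (∀ bifurcation datum, ∃ radius, `SymmetricA3MonodromyRelations`);
  `picardLefschetz_symmetricA3_of_uniform_of_relations` — hB2 itself likewise (bifurcation half by B2-BIF).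

CONDITIONAL in the two named inputs; nothing here proves HC; rung F-H1 is not moved.

References: [VoisinHodgeII2003] Voisin, *Hodge Theory and Complex Algebraic Geometry II*, §2.3.1, §3.1.2, §3.2.1 Thm. 3.16,
§3.2.2; [ArnoldGuseinzadeVarchenko2012] AGZV II, Part I §1.3, §2.8 Thm. 2.14, §2.9 Thm. 2.15, §5.2 (pp. 129–133).
-/

noncomputable section

open CategoryTheory AlgebraicGeometry MvPolynomial Filter Topology
open Literature.AlgebraicTopology.SingularHomology
open Literature.AlgebraicGeometry.Motives Literature.AlgebraicGeometry.Motives.UniversalHypersurface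

namespace Literature.AlgebraicGeometry.HodgeTheory

section HodgeTheory

variable {n d : ℕ} {f₁ g₀ g₂ : MvPolynomial (Fin (n + 2)) ℂ} {j k : Fin (n + 2)} {a : Fin (n + 2) → ℂˣ}
  {εa εb : ℝ} {ψ : ℂ → ℂ}

/-! ### §1 A radius below which `g₀` does not vanish at the nodes of the two-node member -/

/-- **The nodes of `f₁ + a'g₂ + ψ(a')g₀` avoid `{g₀ = 0}` for small `a'`.**  For a symmetric `A₃` datum and a
bifurcation datum `(εa, εb, ψ)` of it there is `0 < εa' ≤ εa` such that for `|a'| < εa'` every singular vector `z ≠ 0`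
of the member `f₁ + a' g₂ + ψ(a') g₀` has `g₀(z) ≠ 0` (the singular points of nearby members lie near the unique
singular point `e_j` of `f₁`, `IsSymmetricA3Datum.eventually_forall_singular_mem`, where `g₀(e_j) ≠ 0`; `ψ` is
continuous at `0` with `ψ(0) = 0`). [cite: ArnoldGuseinzadeVarchenko2012, Part I §5.2] [cite: VoisinHodgeII2003, §2.3.1] -/
theorem IsSymmetricA3Bifurcation.exists_radius_eval_g₀_ne (hf₁ : f₁.IsHomogeneous d) (hg₀ : g₀.IsHomogeneous d)
    (hg₂ : g₂.IsHomogeneous d) (hD : IsSymmetricA3Datum f₁ g₀ g₂ j k a)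
    (hB : IsSymmetricA3Bifurcation f₁ g₀ g₂ j a εa εb ψ) :
    ∃ εa' : ℝ, 0 < εa' ∧ εa' ≤ εa ∧ ∀ a' : ℂ, ‖a'‖ < εa' →
      ∀ z : Fin (n + 2) → ℂ, z ≠ 0 → (∀ i, eval z (pderiv i (f₁ + a' • g₂ + ψ a' • g₀)) = 0) → eval z g₀ ≠ 0 := by
  obtain ⟨hεa, -, hdiff, hψ0, -⟩ := hB
  -- the open set `{g₀ ≠ 0}` around `e_j`
  have hV : IsOpen {z : Fin (n + 2) → ℂ | eval z g₀ ≠ 0} :=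
    isOpen_ne_fun (MvPolynomial.continuous_eval g₀) continuous_const
  have hjV : (Pi.single j (1 : ℂ) : Fin (n + 2) → ℂ) ∈ {z : Fin (n + 2) → ℂ | eval z g₀ ≠ 0} := hD.eval_g₀_ne
  have hev := hD.eventually_forall_singular_mem hf₁ hg₀ hg₂ hV hjV
  -- pull back along the continuous curve `a' ↦ (a', ψ a')`
  have hcont : ContinuousAt ψ 0 :=
    (hdiff.continuousOn.continuousAt (Metric.isOpen_ball.mem_nhds (Metric.mem_ball_self hεa)))
  have hcurve : Tendsto (fun a' : ℂ => (a', ψ a')) (𝓝 0) (𝓝 (0 : ℂ × ℂ)) := by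
    have h := (continuousAt_id.prodMk hcont).tendsto
    rwa [id, hψ0] at h
  have hev' := hcurve.eventually hev
  obtain ⟨ε, hε, hball⟩ := Metric.eventually_nhds_iff.1 hev'
  refine ⟨min ε εa, lt_min hε hεa, min_le_right _ _, fun a' ha z hz hsing => ?_⟩
  have ha' : dist a' 0 < ε := by rw [dist_zero_right]; exact lt_of_lt_of_le ha (min_le_left _ _)
  obtain ⟨hzj, -, hmem, -⟩ := hball ha' z hz hsing
  -- `g₀((z_j)⁻¹ • z) ≠ 0 ⟹ g₀(z) ≠ 0` by homogeneity
  intro h0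
  apply hmem
  rw [UniversalHypersurface.eval_smul_of_isHomogeneous n hg₀, h0, mul_zero]

/-! ### §2 (P1) ∧ (P2) from the uniform nodal Picard–Lefschetz package -/

/-- `(r * E) • g = (((1 : ℝ) : ℂ) * E) • (r • g)`: the complex-radius circle as the radius-`1` circle of the rescaled
co-pencil form. [cite: VoisinHodgeII2003, §2.3.1] -/
private theorem smul_rescale (r E : ℂ) (g : MvPolynomial (Fin (n + 2)) ℂ) :
    (r * E) • g = (((1 : ℝ) : ℂ) * E) • (r • g) := by
  rw [smul_smul, Complex.ofReal_one, one_mul, mul_comm]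

/-- **(P1) ∧ (P2) ⟸ hPL-uniform.**  For a symmetric `A₃` datum, a bifurcation datum `(εa, εb, ψ)`, and the radius of
`IsSymmetricA3Bifurcation.exists_radius_eval_g₀_ne`: granted `picardLefschetz_nodalForms_uniform`, the two circles of hB2
at the midpoint base point carry Picard–Lefschetz data `![e₂]` (one node `e_j` of `f₁ + a'g₂`, pencil direction
`(ψ a'/2)·g₀`, radius `1`) and `![e₁, e₃]` (the two nodes of `f₁ + a'g₂ + ψ(a')g₀`, direction `−(ψ a'/2)·g₀`, radius `1`)
with the COMMON coefficient `c(t₀)` of the flat Picard–Lefschetz coefficient — `SymmetricA3PicardLefschetzPair`.  The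
punctured unit discs of both pencils are nonsingular by the bifurcation clauses (`|b| ≤ |ψ|/2 < |ψ|`, resp.
`b = ψ(1 − c'/2)` with `0 < |c'| ≤ 1`, and `2|ψ| < εb`).
[cite: VoisinHodgeII2003, §3.2.1 Thm. 3.16, §3.2.2 and §2.3.1] [cite: ArnoldGuseinzadeVarchenko2012, Part I §5.2] -/
theorem symmetricA3PicardLefschetzPair_of_uniform (H : picardLefschetz_nodalForms_uniform)
    (hf₁ : f₁.IsHomogeneous d) (hg₀ : g₀.IsHomogeneous d) (hg₂ : g₂.IsHomogeneous d)
    (hD : IsSymmetricA3Datum f₁ g₀ g₂ j k a) (hB : IsSymmetricA3Bifurcation f₁ g₀ g₂ j a εa εb ψ) :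
    ∃ εa' : ℝ, 0 < εa' ∧ εa' ≤ εa ∧ SymmetricA3PicardLefschetzPair n d f₁ g₀ g₂ ψ εa' := by
  obtain ⟨εa', hεa', hle, hgood⟩ := hB.exists_radius_eval_g₀_ne hf₁ hg₀ hg₂ hD
  refine ⟨εa', hεa', hle, fun hn hd hU a' ha ha0 t₀ ht₀ γ₁ γ₂ hγ₁ hγ₂ => ?_⟩
  have haεa : ‖a'‖ < εa := lt_of_lt_of_le ha hle
  obtain ⟨c, hc, hPLr⟩ := H.exists_isPicardLefschetzData_of_radius n d hn hd hU
  -- the bifurcation clauses at `a'`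
  have hψne : ψ a' ≠ 0 := hB.2.2.2.2.1 a' haεa ha0
  have hψb : 2 * ‖ψ a'‖ < εb := hB.2.2.2.2.2.1 a' haεa
  have hψpos : 0 < ‖ψ a'‖ := norm_pos_iff.2 hψne
  obtain ⟨hnod₁, q, hnod₂, -⟩ := hB.2.2.2.2.2.2.2 a' haεa ha0
  -- the two pencils: `F₁ + c'G₁` with `F₁ = f₁ + a'g₂`, `G₁ = (ψ/2)g₀`; `F₂ + c'G₂` with `F₂ = F₁ + ψ g₀`, `G₂ = -(ψ/2)g₀`
  have hF₁h : (f₁ + a' • g₂).IsHomogeneous d := isHomogeneous_add_smul hf₁ hg₂ a'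
  have hF₂h : (f₁ + a' • g₂ + ψ a' • g₀).IsHomogeneous d := isHomogeneous_add_smul hF₁h hg₀ _
  have hG₁h : ((ψ a' / 2) • g₀).IsHomogeneous d := by
    simpa using isHomogeneous_add_smul (isHomogeneous_zero _ _ d) hg₀ (ψ a' / 2)
  have hG₂h : ((-(ψ a' / 2)) • g₀).IsHomogeneous d := by
    simpa using isHomogeneous_add_smul (isHomogeneous_zero _ _ d) hg₀ (-(ψ a' / 2))
  have hline₁ : ∀ c' : ℂ, f₁ + a' • g₂ + c' • ((ψ a' / 2) • g₀) = f₁ + a' • g₂ + (c' * (ψ a' / 2)) • g₀ :=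
    fun c' => by rw [smul_smul]
  have hline₂ : ∀ c' : ℂ, f₁ + a' • g₂ + ψ a' • g₀ + c' • ((-(ψ a' / 2)) • g₀) =
      f₁ + a' • g₂ + (ψ a' - c' * (ψ a' / 2)) • g₀ := fun c' => by
    rw [smul_smul, sub_smul, mul_neg, neg_smul]; abel
  -- nonsingularity of the punctured unit discs
  have hbnd : ∀ c' : ℂ, ‖c'‖ ≤ 1 → ‖c' * (ψ a' / 2)‖ ≤ ‖ψ a'‖ / 2 := fun c' hc1 => by
    rw [norm_mul, norm_div, Complex.norm_two]
    nlinarith [norm_nonneg (ψ a'), norm_nonneg c']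
  have hns₁ : ∀ c' : ℂ, c' ≠ 0 → ‖c'‖ ≤ 1 →
      SmoothHypersurface.IsNonsingularForm ℂ (f₁ + a' • g₂ + c' • ((ψ a' / 2) • g₀)) := by
    intro c' hc' hc1
    have hb := hbnd c' hc1
    rw [hline₁]
    refine hB.isNonsingularForm haεa (by linarith) (mul_ne_zero hc' (div_ne_zero hψne two_ne_zero)) ?_
    intro h
    rw [h] at hb
    linarith
  have hns₂ : ∀ c' : ℂ, c' ≠ 0 → ‖c'‖ ≤ 1 →
      SmoothHypersurface.IsNonsingularForm ℂ (f₁ + a' • g₂ + ψ a' • g₀ + c' • ((-(ψ a' / 2)) • g₀)) := by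
    intro c' hc' hc1
    have hb := hbnd c' hc1
    rw [hline₂]
    refine hB.isNonsingularForm haεa ?_ ?_ ?_
    · calc ‖ψ a' - c' * (ψ a' / 2)‖ ≤ ‖ψ a'‖ + ‖c' * (ψ a' / 2)‖ := norm_sub_le _ _
        _ < εb := by linarith
    · intro h
      rw [sub_eq_zero] at h
      rw [← h] at hb
      linarith
    · intro h
      have h' : c' * (ψ a' / 2) = 0 := by linear_combination -h
      exact mul_ne_zero hc' (div_ne_zero hψne two_ne_zero) h'
  -- the co-pencil forms miss the nodes
  have hG₁e : ∀ i : Fin 1, eval ((![Pi.single j (1 : ℂ)] : Fin 1 → Fin (n + 2) → ℂ) i) ((ψ a' / 2) • g₀) ≠ 0 := by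
    intro i
    fin_cases i
    simp only [smul_eval, Matrix.cons_val_fin_one]
    exact mul_ne_zero (div_ne_zero hψne two_ne_zero) hD.eval_g₀_ne
  have hG₂q : ∀ i : Fin 2, eval (q i) ((-(ψ a' / 2)) • g₀) ≠ 0 := by
    intro i
    rw [smul_eval]
    refine mul_ne_zero (neg_ne_zero.2 (div_ne_zero hψne two_ne_zero)) ?_
    exact hgood a' ha (q i) (hnod₂.1 i).ne_zero (hnod₂.1 i).eval_pderiv
  -- the base point and the circles in the radius-`1` idiom
  have ht₁ : pointForm ℂ n d t₀ = f₁ + a' • g₂ + ((1 : ℝ) : ℂ) • ((ψ a' / 2) • g₀) := by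
    rw [ht₀, Complex.ofReal_one, one_smul]
  have ht₂ : pointForm ℂ n d t₀ = f₁ + a' • g₂ + ψ a' • g₀ + ((1 : ℝ) : ℂ) • ((-(ψ a' / 2)) • g₀) := by
    rw [ht₀, hline₂]
    congr 2
    rw [Complex.ofReal_one]
    ring
  have hc₁ : IsPencilCircle n d (f₁ + a' • g₂) ((ψ a' / 2) • g₀) 1 γ₁ := fun θ => by
    rw [hγ₁ θ, ← smul_rescale]
  have hc₂ : IsPencilCircle n d (f₁ + a' • g₂ + ψ a' • g₀) ((-(ψ a' / 2)) • g₀) 1 γ₂ := fun θ => by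
    rw [hγ₂ θ, hline₂, Complex.ofReal_one, one_mul, mul_comm]
  -- the Picard–Lefschetz data, both with the coefficient `c t₀`
  obtain ⟨δ₁, hPL₁⟩ := hPLr 1 _ _ hF₁h hG₁h _ hnod₁ hG₁e 1 one_pos hns₁ t₀ ht₁ γ₁ hc₁
  obtain ⟨δ₂, hPL₂⟩ := hPLr 2 _ _ hF₂h hG₂h q hnod₂ hG₂q 1 one_pos hns₂ t₀ ht₂ γ₂ hc₂
  have e₁ : (![δ₁ 0] : Fin 1 → bettiCohomology (fiberOver (family ℂ n d) t₀) n) = δ₁ := by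
    funext i; fin_cases i; rfl
  have e₂ : (![δ₂ 0, δ₂ 1] : Fin 2 → bettiCohomology (fiberOver (family ℂ n d) t₀) n) = δ₂ := by
    funext i; fin_cases i <;> rfl
  exact ⟨c t₀, δ₂ 0, δ₁ 0, δ₂ 1, e₁ ▸ hPL₁, e₂ ▸ hPL₂⟩

/-! ### §3 Assembly: hB2-PL and hB2 from hPL-uniform and the `A₃` relations -/

/-- **hB2-PL (inline, registry form) ⟸ (∀ bifurcation datum, ∃ radius, Pair) ∧ (∀ bifurcation datum, ∃ radius,
Relations)**: shrink to the smaller radius and re-choose the gauge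
(`symmetricA3PicardLefschetzClauses_of_pair_of_relations`).
[cite: ArnoldGuseinzadeVarchenko2012, Part I §5.2 and §2.9 Thm. 2.15] [cite: VoisinHodgeII2003, §3.2.1 Thm. 3.16] -/
theorem symmetricA3PicardLefschetzClauses_inline_of_pair_of_relations
    (hP : ∀ (n d : ℕ) (f₁ g₀ g₂ : MvPolynomial (Fin (n + 2)) ℂ) (j k : Fin (n + 2)) (a : Fin (n + 2) → ℂˣ),
      f₁.IsHomogeneous d → g₀.IsHomogeneous d → g₂.IsHomogeneous d → IsSymmetricA3Datum f₁ g₀ g₂ j k a →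
      ∀ (εa εb : ℝ) (ψ : ℂ → ℂ), IsSymmetricA3Bifurcation f₁ g₀ g₂ j a εa εb ψ →
        ∃ εa' : ℝ, 0 < εa' ∧ εa' ≤ εa ∧ SymmetricA3PicardLefschetzPair n d f₁ g₀ g₂ ψ εa')
    (hR : ∀ (n d : ℕ) (f₁ g₀ g₂ : MvPolynomial (Fin (n + 2)) ℂ) (j k : Fin (n + 2)) (a : Fin (n + 2) → ℂˣ),
      f₁.IsHomogeneous d → g₀.IsHomogeneous d → g₂.IsHomogeneous d → IsSymmetricA3Datum f₁ g₀ g₂ j k a →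
      ∀ (εa εb : ℝ) (ψ : ℂ → ℂ), IsSymmetricA3Bifurcation f₁ g₀ g₂ j a εa εb ψ →
        ∃ εa' : ℝ, 0 < εa' ∧ εa' ≤ εa ∧ SymmetricA3MonodromyRelations n d f₁ g₀ g₂ ψ εa')
    (n d : ℕ) (f₁ g₀ g₂ : MvPolynomial (Fin (n + 2)) ℂ) (j k : Fin (n + 2)) (a : Fin (n + 2) → ℂˣ)
    (hf₁ : f₁.IsHomogeneous d) (hg₀ : g₀.IsHomogeneous d) (hg₂ : g₂.IsHomogeneous d)
    (hD : IsSymmetricA3Datum f₁ g₀ g₂ j k a) (εa εb : ℝ) (ψ : ℂ → ℂ)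
    (hB : IsSymmetricA3Bifurcation f₁ g₀ g₂ j a εa εb ψ) :
    ∃ εa' : ℝ, 0 < εa' ∧ εa' ≤ εa ∧ SymmetricA3PicardLefschetzClauses n d f₁ g₀ g₂ ψ εa' := by
  obtain ⟨ε₁, h₁, h₁le, hP₁⟩ := hP n d f₁ g₀ g₂ j k a hf₁ hg₀ hg₂ hD εa εb ψ hB
  obtain ⟨ε₂, h₂, h₂le, hR₂⟩ := hR n d f₁ g₀ g₂ j k a hf₁ hg₀ hg₂ hD εa εb ψ hB
  exact ⟨min ε₁ ε₂, lt_min h₁ h₂, (min_le_left _ _).trans h₁le,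
    symmetricA3PicardLefschetzClauses_of_pair_of_relations (hP₁.mono (min_le_left _ _))
      (hR₂.mono (min_le_right _ _))⟩

/-- **hB2-PL (inline, as in registry v18 of K1-B) ⟸ hPL-uniform ∧ (the `A₃` relations inside every bifurcation
datum)** — programme «B2PL-SPLIT»: the Picard–Lefschetz existence content of hB2 is paid by the uniform nodal package,
the residue is the operator-level `A₃` statement `SymmetricA3MonodromyRelations`.
[cite: VoisinHodgeII2003, §3.2.1 Thm. 3.16 and §3.2.2] [cite: ArnoldGuseinzadeVarchenko2012, Part I §5.2 and §2.9 Thm. 2.15] -/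
theorem symmetricA3PicardLefschetzClauses_inline_of_uniform_of_relations (H : picardLefschetz_nodalForms_uniform)
    (hR : ∀ (n d : ℕ) (f₁ g₀ g₂ : MvPolynomial (Fin (n + 2)) ℂ) (j k : Fin (n + 2)) (a : Fin (n + 2) → ℂˣ),
      f₁.IsHomogeneous d → g₀.IsHomogeneous d → g₂.IsHomogeneous d → IsSymmetricA3Datum f₁ g₀ g₂ j k a →
      ∀ (εa εb : ℝ) (ψ : ℂ → ℂ), IsSymmetricA3Bifurcation f₁ g₀ g₂ j a εa εb ψ →
        ∃ εa' : ℝ, 0 < εa' ∧ εa' ≤ εa ∧ SymmetricA3MonodromyRelations n d f₁ g₀ g₂ ψ εa')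
    (n d : ℕ) (f₁ g₀ g₂ : MvPolynomial (Fin (n + 2)) ℂ) (j k : Fin (n + 2)) (a : Fin (n + 2) → ℂˣ)
    (hf₁ : f₁.IsHomogeneous d) (hg₀ : g₀.IsHomogeneous d) (hg₂ : g₂.IsHomogeneous d)
    (hD : IsSymmetricA3Datum f₁ g₀ g₂ j k a) (εa εb : ℝ) (ψ : ℂ → ℂ)
    (hB : IsSymmetricA3Bifurcation f₁ g₀ g₂ j a εa εb ψ) :
    ∃ εa' : ℝ, 0 < εa' ∧ εa' ≤ εa ∧ SymmetricA3PicardLefschetzClauses n d f₁ g₀ g₂ ψ εa' :=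
  symmetricA3PicardLefschetzClauses_inline_of_pair_of_relations
    (fun _ _ _ _ _ _ _ _ hf₁ hg₀ hg₂ hD _ _ _ hB => symmetricA3PicardLefschetzPair_of_uniform H hf₁ hg₀ hg₂ hD hB)
    hR n d f₁ g₀ g₂ j k a hf₁ hg₀ hg₂ hD εa εb ψ hB

/-- **hB2 = `picardLefschetz_symmetricA3` ⟸ hPL-uniform ∧ (the `A₃` relations)**: bifurcation half by programme
B2-BIF (`IsSymmetricA3Datum.exists_isSymmetricA3Bifurcation`), Picard–Lefschetz pair data by the uniform nodal package,
chain and non-commutation by the gauge re-choice from the operator relations.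
[cite: ArnoldGuseinzadeVarchenko2012, Part I §5.2, §2.9 Thm. 2.15, §2.8 Thm. 2.14] [cite: VoisinHodgeII2003, §3.2.1 Thm. 3.16] -/
theorem picardLefschetz_symmetricA3_of_uniform_of_relations (H : picardLefschetz_nodalForms_uniform)
    (hR : ∀ (n d : ℕ) (f₁ g₀ g₂ : MvPolynomial (Fin (n + 2)) ℂ) (j k : Fin (n + 2)) (a : Fin (n + 2) → ℂˣ),
      f₁.IsHomogeneous d → g₀.IsHomogeneous d → g₂.IsHomogeneous d → IsSymmetricA3Datum f₁ g₀ g₂ j k a →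
      ∀ (εa εb : ℝ) (ψ : ℂ → ℂ), IsSymmetricA3Bifurcation f₁ g₀ g₂ j a εa εb ψ →
        ∃ εa' : ℝ, 0 < εa' ∧ εa' ≤ εa ∧ SymmetricA3MonodromyRelations n d f₁ g₀ g₂ ψ εa') :
    picardLefschetz_symmetricA3 :=
  IsSymmetricA3Datum.picardLefschetz_symmetricA3_of_PL (symmetricA3PicardLefschetzClauses_inline_of_uniform_of_relations H hR)

/-- **Conversely, hB2 implies the relations inside its own bifurcation datum** (for the registry's audit: the new
residue is implied by the old binder). [cite: ArnoldGuseinzadeVarchenko2012, Part I §5.2 and §2.9 Thm. 2.15] -/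
theorem picardLefschetz_symmetricA3.exists_relations (H : picardLefschetz_symmetricA3) (hn : 1 ≤ n) (hd : 1 ≤ d)
    (hf₁ : f₁.IsHomogeneous d) (hg₀ : g₀.IsHomogeneous d) (hg₂ : g₂.IsHomogeneous d)
    (hD : IsSymmetricA3Datum f₁ g₀ g₂ j k a) :
    ∃ (εa εb : ℝ) (ψ : ℂ → ℂ), IsSymmetricA3Bifurcation f₁ g₀ g₂ j a εa εb ψ ∧
      SymmetricA3MonodromyRelations n d f₁ g₀ g₂ ψ εa := by
  obtain ⟨εa, εb, ψ, hB, hcl⟩ := H n d f₁ g₀ g₂ j k a hf₁ hg₀ hg₂ hD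
  exact ⟨εa, εb, ψ, hB, SymmetricA3PicardLefschetzClauses.relations hn hd hcl⟩

end HodgeTheory

end Literature.AlgebraicGeometry.HodgeTheory

end
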